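import Summits.Ventures.GridStability.Bench.TOYDeg2hand
import Summits.Ventures.GridStability.Lyapunov.CertificateSoundness
import Mathlib.Analysis.Calculus.Deriv.Mul
import Mathlib.Analysis.Calculus.Deriv.Pow
import Mathlib.Analysis.Calculus.Deriv.Prod
import Mathlib.Analysis.Normed.Module.FiniteDimension
import HarnessLib

/-!
# G1.TOY-roa — WORKED EXAMPLE of the certificate bridge (README): from the kernel-checked TOY
# certificate `Bench/TOYDeg2hand.lean` to invariance + attraction FOR THE RECAST MODEL

Venture GRIDFUSION, PARTITION A2/A5; seat gridfusion-lyap-1. TEST-INSTANCE (model `M_toy`: recast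
damped pendulum `ṡ = (1−c)w, ċ = sw, ẇ = −w − s` on `{c² + s² − 2c = 0}`, unit coefficients, no
locator, not a benchmark). CERTIFIED inputs (kernel, `TOYDeg2hand.lean`): `deg2_hand_V_pos`
(`(w² + s²)/4 ≤ V` on `{h = 0}`) and `deg2_hand_Vdot_neg` (`V̇ ≤ −(w² + s²)/8` on `{c ≥ 0} ∩ {h = 0}`).
MODELLED: the theorem below is about the ODE `ż = F(z)` only; nothing here says a pendulum or a
grid is stable. The obligations O1–O7 are the ones every «…Roa» file discharges (real instances:
`SMIBDeg2AK13postD10Roa.lean`, which also does the original-coordinate step O8–O10 with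
`Lyapunov/AngleRecovery.lean`); the analysis is `Lyapunov.certificate_invariance_tendsto_univ`.
-/

namespace Summit.Ventures.GridStability.Bench.TOY

open Set Filter Metric Topology Summit.Ventures.GridStability.Lyapunov

noncomputable section

/-- Recast TOY field on the phase space `Fin 3 → ℝ` (`z 0 = s`, `z 1 = c`, `z 2 = w`). [folklore] -/
def deg2_hand_F (z : Fin 3 → ℝ) : Fin 3 → ℝ :=
  ![deg2_hand_f_s (z 0) (z 1) (z 2), deg2_hand_f_c (z 0) (z 1) (z 2), deg2_hand_f_w (z 0) (z 1) (z 2)]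
/-- `V` on the phase space. [folklore] -/
def deg2_hand_Vz (z : Fin 3 → ℝ) : ℝ := deg2_hand_V (z 0) (z 1) (z 2)
/-- `V̇ = ∇V·F` (the emitted `Vdot`). [folklore] -/
def deg2_hand_LVz (z : Fin 3 → ℝ) : ℝ := deg2_hand_Vdot (z 0) (z 1) (z 2)
/-- The certified dissipation rate `W = (w² + s²)/8`. [folklore] -/
def deg2_hand_Wz (z : Fin 3 → ℝ) : ℝ := (1 / 8 : ℝ) * ((1 : ℝ) * z 2 ^ 2 + (1 : ℝ) * z 0 ^ 2)
/-- The constraint set `M = {h = 0}`. [folklore] -/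
def deg2_hand_M : Set (Fin 3 → ℝ) := {z | deg2_hand_h (z 0) (z 1) (z 2) = 0}

/-- O1: on `M`, `0 ≤ c ≤ 2` (`c(2 − c) = s²`), so the Bench domain hypothesis `0 ≤ 1·c` holds. [folklore] -/
theorem deg2_hand_c_bounds {s c w : ℝ} (hh : deg2_hand_h s c w = 0) : 0 ≤ c ∧ c ≤ 2 := by
  rw [deg2_hand_h_eq] at hh
  constructor <;> nlinarith [sq_nonneg s, sq_nonneg (c - 1)]

/-- O2: the dissipation inequality `LV ≤ −W` on `M` (CERTIFIED input `deg2_hand_Vdot_neg`). [folklore] -/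
theorem deg2_hand_LVz_le {z : Fin 3 → ℝ} (hz : z ∈ deg2_hand_M) : deg2_hand_LVz z ≤ -deg2_hand_Wz z := by
  have hh : deg2_hand_h (z 0) (z 1) (z 2) = 0 := hz
  have h := deg2_hand_Vdot_neg (z 0) (z 1) (z 2) (by linarith [(deg2_hand_c_bounds hh).1]) hh
  simp only [deg2_hand_LVz, deg2_hand_Wz]
  linarith

/-- O3: on `M ∩ {V ≤ γ}`, `γ < 2` (= `V` at the upper equilibrium `(0, 2, 0)`), `W = 0` only at `0`. [folklore] -/
theorem deg2_hand_eq_zero_of_Wz {z : Fin 3 → ℝ} {γ : ℝ} (hγ : γ < 2) (hz : z ∈ deg2_hand_M)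
    (hV : deg2_hand_Vz z ≤ γ) (hW : deg2_hand_Wz z = 0) : z = 0 := by
  have hh : deg2_hand_h (z 0) (z 1) (z 2) = 0 := hz
  simp only [deg2_hand_Wz] at hW
  have hs : z 0 = 0 := by nlinarith [sq_nonneg (z 0), sq_nonneg (z 2)]
  have hw : z 2 = 0 := by nlinarith [sq_nonneg (z 0), sq_nonneg (z 2)]
  simp only [deg2_hand_h_eq, hs] at hh
  simp only [deg2_hand_Vz, deg2_hand_V_eq, hs, hw] at hV
  have hc : z 1 = 0 := by
    rcases mul_eq_zero.1 (show z 1 * (z 1 - 2) = 0 by nlinarith [hh]) with h | h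
    · exact h
    · exfalso; linarith
  funext i
  fin_cases i <;> simp [hs, hc, hw]

/-- O4: `W > 0` on the level surface `{V = γ}` for `0 < γ < 2`. [folklore] -/
theorem deg2_hand_Wz_pos {z : Fin 3 → ℝ} {γ : ℝ} (hγ0 : 0 < γ) (hγ : γ < 2)
    (hz : z ∈ deg2_hand_M) (hV : deg2_hand_Vz z = γ) : 0 < deg2_hand_Wz z := by
  have hW0 : 0 ≤ deg2_hand_Wz z := by simp only [deg2_hand_Wz]; positivity
  rcases hW0.lt_or_eq with h | h
  · exact h
  · have hz0 := deg2_hand_eq_zero_of_Wz hγ hz hV.le h.symm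
    subst hz0
    simp [deg2_hand_Vz, deg2_hand_V_eq] at hV
    linarith

/-- O5: the piece `{z ∈ M | V z ≤ γ}` is compact (CERTIFIED input `deg2_hand_V_pos` + O1). [folklore] -/
theorem deg2_hand_isCompact_S {γ : ℝ} (hγ0 : 0 ≤ γ) :
    IsCompact {z ∈ deg2_hand_M | deg2_hand_Vz z ≤ γ} := by
  have hMc : IsClosed deg2_hand_M := by
    simp only [deg2_hand_M, deg2_hand_h_eq]; exact isClosed_eq (by fun_prop) continuous_const
  have hVc : Continuous deg2_hand_Vz := by unfold deg2_hand_Vz; simp only [deg2_hand_V_eq]; fun_prop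
  have h := isCompact_sublevel_of_norm_le (D := univ) (c := γ) (R := 2 + γ) hMc isClosed_univ
    hVc.continuousOn ?_
  · rwa [inter_univ] at h
  rintro z ⟨hz, -⟩ hV
  have hh : deg2_hand_h (z 0) (z 1) (z 2) = 0 := hz
  obtain ⟨hc0, hc2⟩ := deg2_hand_c_bounds hh
  have hpos := deg2_hand_V_pos (z 0) (z 1) (z 2) (by linarith) hh
  simp only [deg2_hand_Vz] at hV
  have hb0 : |z 0| ≤ 2 + γ :=
    abs_le.2 (abs_le_of_sq_le_sq' (by nlinarith [sq_nonneg (z 2), sq_nonneg γ]) (by linarith))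
  have hb2 : |z 2| ≤ 2 + γ :=
    abs_le.2 (abs_le_of_sq_le_sq' (by nlinarith [sq_nonneg (z 0), sq_nonneg γ]) (by linarith))
  refine (pi_norm_le_iff_of_nonneg (by linarith)).2 fun i ↦ ?_
  rw [Real.norm_eq_abs]
  fin_cases i
  · simpa using hb0
  · simpa using abs_le.2 ⟨by linarith, by linarith⟩
  · simpa using hb2

/-- O6: chain rule — along a curve with right derivative `F (z t)`, `V ∘ z` has derivative `Vdot (z t)`. [folklore] -/
theorem deg2_hand_hasDerivWithinAt_Vz {z : ℝ → Fin 3 → ℝ} {t : ℝ} {s : Set ℝ}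
    (hz : HasDerivWithinAt z (deg2_hand_F (z t)) s t) :
    HasDerivWithinAt (deg2_hand_Vz ∘ z) (deg2_hand_LVz (z t)) s t := by
  have h0 := (hasDerivWithinAt_pi.1 hz) 0
  have h1 := (hasDerivWithinAt_pi.1 hz) 1
  have h2 := (hasDerivWithinAt_pi.1 hz) 2
  simp only [deg2_hand_F, Matrix.cons_val_zero, Matrix.cons_val_one, Matrix.cons_val] at h0 h1 h2
  have heq : deg2_hand_Vz ∘ z =
      fun τ ↦ (1 : ℝ) / 2 * z τ 2 ^ 2 + (1 : ℝ) / 4 * (z τ 0 * z τ 2) + 1 * z τ 1 := by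
    funext τ; simp only [Function.comp_apply, deg2_hand_Vz]
    linear_combination deg2_hand_V_eq (z τ 0) (z τ 1) (z τ 2)
  rw [heq]
  refine ((((h2.fun_pow 2).const_mul _).fun_add ((h0.fun_mul h2).const_mul _)).fun_add
    (h1.const_mul _)).congr_deriv ?_
  simp only [deg2_hand_LVz, deg2_hand_Vdot_eq, deg2_hand_f_s_eq, deg2_hand_f_c_eq, deg2_hand_f_w_eq]
  push_cast
  ring

/-- O7: `h` is a first integral, so a solution starting on `M` stays on `M`. [folklore] -/
theorem deg2_hand_mem_M {z : ℝ → Fin 3 → ℝ} (hzc : ContinuousOn z (Ici 0))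
    (hz : ∀ t, 0 ≤ t → HasDerivWithinAt z (deg2_hand_F (z t)) (Ici t) t)
    (h0 : z 0 ∈ deg2_hand_M) : ∀ t, 0 ≤ t → z t ∈ deg2_hand_M := by
  intro T hT
  have hderiv : ∀ t ∈ Ico 0 T,
      HasDerivWithinAt (fun τ ↦ deg2_hand_h (z τ 0) (z τ 1) (z τ 2)) 0 (Ici t) t := by
    intro t ht
    have h0' := (hasDerivWithinAt_pi.1 (hz t ht.1)) 0
    have h1' := (hasDerivWithinAt_pi.1 (hz t ht.1)) 1
    simp only [deg2_hand_F, Matrix.cons_val_zero, Matrix.cons_val_one] at h0' h1'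
    have heq : (fun τ ↦ deg2_hand_h (z τ 0) (z τ 1) (z τ 2)) =
        fun τ ↦ (1 : ℝ) * z τ 1 ^ 2 + (1 : ℝ) * z τ 0 ^ 2 + (-2 : ℝ) * z τ 1 := by
      funext τ; linear_combination deg2_hand_h_eq (z τ 0) (z τ 1) (z τ 2)
    rw [heq]
    refine ((((h1'.fun_pow 2).const_mul _).fun_add ((h0'.fun_pow 2).const_mul _)).fun_add
      (h1'.const_mul _)).congr_deriv ?_
    simp only [deg2_hand_f_s_eq, deg2_hand_f_c_eq]
    push_cast
    ring
  have hcont : ContinuousOn (fun τ ↦ deg2_hand_h (z τ 0) (z τ 1) (z τ 2)) (Icc 0 T) := by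
    have hc : Continuous fun y : Fin 3 → ℝ ↦ deg2_hand_h (y 0) (y 1) (y 2) := by
      simp only [deg2_hand_h_eq]; fun_prop
    exact hc.comp_continuousOn (hzc.mono fun s hs ↦ hs.1)
  have h0' : deg2_hand_h (z 0 0) (z 0 1) (z 0 2) = 0 := h0
  show deg2_hand_h (z T 0) (z T 1) (z T 2) = 0
  rw [constant_of_has_deriv_right_zero hcont hderiv T ⟨hT, le_rfl⟩, h0']

/-- **G1.TOY-roa.** For every level `0 < γ < 2` and every solution `z` of the recast TOY system on
`[0, ∞)` starting on `M` with `V(z 0) ≤ γ`: `V(z t) ≤ γ` for all `t ≥ 0` (the piece `{V ≤ γ} ∩ M` is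
positively invariant) and `z t → 0` (it lies in the region of attraction of the origin) — by
`Lyapunov.certificate_invariance_tendsto_univ`. MODELLED (model `M_toy`, TEST-INSTANCE). [folklore] -/
theorem deg2_hand_roa {γ : ℝ} (hγ0 : 0 < γ) (hγ : γ < 2) {z : ℝ → Fin 3 → ℝ}
    (hzc : ContinuousOn z (Ici 0)) (hz : ∀ t, 0 ≤ t → HasDerivWithinAt z (deg2_hand_F (z t)) (Ici t) t)
    (h0M : z 0 ∈ deg2_hand_M) (h0V : deg2_hand_Vz (z 0) ≤ γ) :
    (∀ t, 0 ≤ t → deg2_hand_Vz (z t) ≤ γ) ∧ Tendsto z atTop (𝓝 0) := by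
  have hF : Continuous deg2_hand_F := by
    refine continuous_pi fun i ↦ ?_
    fin_cases i <;> simp [deg2_hand_F, deg2_hand_f_s_eq, deg2_hand_f_c_eq, deg2_hand_f_w_eq] <;> fun_prop
  have hV : Continuous deg2_hand_Vz := by unfold deg2_hand_Vz; simp only [deg2_hand_V_eq]; fun_prop
  have hW : Continuous deg2_hand_Wz := by unfold deg2_hand_Wz; fun_prop
  have h0 : (0 : Fin 3 → ℝ) ∈ deg2_hand_M := by simp [deg2_hand_M, deg2_hand_h_eq]
  exact certificate_invariance_tendsto_univ (M := deg2_hand_M) (LV := deg2_hand_LVz)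
    (W := deg2_hand_Wz) (x₀ := 0) (deg2_hand_isCompact_S hγ0.le)
    hF.continuousOn hV.continuousOn hW.continuousOn (fun y hy _ ↦ deg2_hand_LVz_le hy)
    (fun y _ _ ↦ by simp only [deg2_hand_Wz]; positivity)
    (fun y hy hVy ↦ deg2_hand_Wz_pos hγ0 hγ hy hVy)
    h0 (by simp [deg2_hand_Vz, deg2_hand_V_eq]; exact hγ0.le) (by simp [deg2_hand_Wz])
    (fun y hy hVy hWy ↦ deg2_hand_eq_zero_of_Wz hγ hy hVy hWy)
    hzc hz (fun t ht ↦ deg2_hand_hasDerivWithinAt_Vz (hz t ht)) (deg2_hand_mem_M hzc hz h0M) h0V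

end

end Summit.Ventures.GridStability.Bench.TOY
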